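import Summits.BirchSwinnertonDyer.Rank1Residual.Partition.YanZhuImForm
import Summits.BirchSwinnertonDyer.BirchSwinnertonDyer.Theorems.ToricSheddingUBPotentiallyGoodStubTwistAdmissible
import Literature.NumberTheory.EllipticCurves.TateModuleDeterminantProofs
import Literature.NumberTheory.EllipticCurves.TateModuleFreeProofs
import Literature.NumberTheory.EllipticCurves.TateModuleFinrankProofs
import Literature.NumberTheory.EllipticCurves.WeilPairingProofs
import Literature.NumberTheory.EllipticCurves.ExceptionalPrimesDensityModels
import HarnessLib

/-!
# Yan–Zhu's hypothesis (Im) is stable under quadratic twist at every odd prime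
# (cell `bsd-litref`, paper sub-dir `yz26`, seat `bsd-litref-yz26-pv`; LADDER-BSD H1 / W7, row D3)

HONEST FRAMING (programme `BSD-LIT2PART-PROGRAMME-v1.md` §HONESTY, verbatim): «no tranche here
proves BSD; ARM L moves the LITERAL column of an r ≤ 1 census into the
kernel-proved-modulo-named-print column; ARM P changes what «named print» is worth.» Theorems
only; no named fact is introduced.

## The proof-internal hypothesis this file discharges, for EVERY curve

Yan–Zhu, J. Algebra 693 (2026) = arXiv:2412.20078v4, prove the cyclotomic main conjecture for `E`
(Thm. 5.2 = v2 Thm. 4.9) by restricting the two-variable main conjecture over an imaginary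
quadratic `K` to the cyclotomic line, where it factors as MC(`E/ℚ_∞`) × MC(`E^K/ℚ_∞`), and
invoking Kato's divisibility [Kato, Thm. 17.14] for `E` AND for the twist `E^K` "in `Λ_ℚ` under
the condition (Im)" (v4 l.1146–1148); Cor. 5.4 — the `r = 1` leg of Thm. 5.11 (= v2 Thm. 4.15,
scoreboard row D3's binder `YanZhu2026.thm415_padicValRat_bsd_rank_le_one[_of_bigIm]`) — is
"Theorem 5.2 (applied to `E` and `E^K`)" (l.1183). The printed statements carry (Im) for `E` only:
"(Im) for `E^K`" is a hypothesis AS USED that is not a hypothesis AS STATED. This file proves, in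
the kernel and for every elliptic curve over `ℚ`, that it is implied by the stated one:

* `bigIm_of_addEquiv_signed`, `bigIm_quadraticTwist_iff`, `bigIm_iff_of_model_twist` — **for an
  odd prime `p` and `d ∈ ℚ^×`, `E` satisfies (Im) at `p` iff `E^{(d)}` does** (any `ℚ`-model of
  the twist). Hence Yan–Zhu's silent step is sound as printed (`p > 2` throughout the paper), and
  a D-audit line on it is VERBATIM, not a GAP — for all curves, not only row D3.

Mechanism (folklore; the remark "`τ²` works at odd `p`"): let `τ ∈ G_{ℚ(μ_{p^∞})}` be an
(Im)-witness for `E`, `N = ρ_E(τ) - 1`, so `T_pE/N T_pE ≅ ℤ_p`. The Weil pairing gives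
`det ρ_E(τ) = χ_p(τ) = 1` (tree theorem `toZModPow_det_galoisRepTate_eq` at every level), and an
endomorphism `1 + N` of a rank-two lattice with `det = 1` whose `N` has a cokernel mapping ONTO
`ℤ_p` satisfies `N² = 0` (`comp_self_eq_zero_of_det_eq_one`: in a basis, `λ ∘ N = 0` for an onto
functional `λ` forces `det N = 0`, then `det(1 + N) = 1` forces `tr N = 0`, Cayley–Hamilton). So
`ρ_E(τ²) - 1 = 2N` has the same range as `N` (`2 ∈ ℤ_p^×`, `p` odd): `τ²` is again a witness
(`range_galoisRepTate_sq_sub_id_eq`). Along the `χ_d`-equivariant isomorphism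
`E^{(d)}(ℚ̄) ≃+ E(ℚ̄)` (`exists_addEquiv_geomPoints_quadraticTwist_signed`, Silverman *AEC* X.5
Cor. 5.4) the Tate modules are identified compatibly with `τ²` (the sign `χ_d(τ) = ±1` squares
away: `exists_tateModule_equiv_sq_of_addEquiv_signed`), so `τ²` is a witness for `E^{(d)}` too.
At `p = 2` the statement is false in general (`2N` has index `2` in `N T`), matching the paper's
standing `p > 2`.

* `bigIm_twist_of_bigIm` — the form consumers want: `p ≠ 2`, (Im) for `E` ⟹ (Im) for any model of
  any quadratic twist; `RowC16.bigIm_twist_of_imHyp` — on row C16 / D3 (`p = 3`) from the row's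
  own (Im) (`RowC16.bigIm`, granted Wuthrich 2014 Lemma 20), every twist `E^K` satisfies (Im).

References: X. Yan, X. Zhu, J. Algebra 693 (2026) 372–402 = arXiv:2412.20078v4, (Im) l.349–351,
proof of Thm. 5.2 l.1140–1160, Cor. 5.4 l.1166–1184; K. Kato, Astérisque 295 (2004) Thm. 17.4;
C. Skinner, Pacific J. Math. 283 (2016) §2.5 (b), p. 187; J. H. Silverman, *AEC* III.7.1, III.8.1,
X.5 Cor. 5.4; tree `TateModuleDeterminantProofs`, `TateModuleGaloisTransportProofs` (pattern of
`exists_rationalTateModule_equiv_of_addEquiv`), `Rank1Residual/Predicates.lean` (`BigIm`).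
-/

set_option autoImplicit false

noncomputable section

open scoped Classical

open WeierstrassCurve Field Literature.NumberTheory.EllipticCurves
  Literature.NumberTheory.EllipticCurves.Rank1Residual
  Summit.BirchSwinnertonDyer.BirchSwinnertonDyer.Theorems

namespace Summit.BirchSwinnertonDyer.Rank1Residual

/-! ### §1 Linear algebra on a rank-two lattice -/

/-- **A determinant-one endomorphism `1 + N` of a free rank-two module, with `N` killed by an onto
linear functional, has `N ∘ N = 0`.** In a basis write `N = (a b; c d)` and `λ = (l₁ l₂)` with
`x l₁ + y l₂ = 1`: `λ ∘ N = 0` gives `l₁ a + l₂ c = l₁ b + l₂ d = 0`, whence `det N = ad - bc = 0`;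
`det(1 + N) = 1 + (a + d) + det N = 1` gives `a + d = 0`; and a `2 × 2` matrix with zero trace and
determinant squares to zero (Cayley–Hamilton). Pure commutative algebra over any commutative ring.
[folklore] -/
theorem comp_self_eq_zero_of_det_eq_one {R M : Type*} [CommRing R] [AddCommGroup M] [Module R M]
    (b : Module.Basis (Fin 2) R M) (N : M →ₗ[R] M) (l : M →ₗ[R] R)
    (hlN : ∀ x, l (N x) = 0) (hl : Function.Surjective l)
    (hdet : LinearMap.det (LinearMap.id + N) = 1) : N ∘ₗ N = 0 := by
  obtain ⟨A, hA⟩ : ∃ A : Matrix (Fin 2) (Fin 2) R, LinearMap.toMatrix b b N = A := ⟨_, rfl⟩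
  -- columns of `A` are the coordinates of `N (b j)`
  have hcol : ∀ j, N (b j) = A 0 j • b 0 + A 1 j • b 1 := fun j ↦ by
    conv_lhs => rw [← b.sum_repr (N (b j))]
    rw [Fin.sum_univ_two, ← hA, LinearMap.toMatrix_apply, LinearMap.toMatrix_apply]
  -- `λ ∘ N = 0` on the basis
  have h1 : l (b 0) * A 0 0 + l (b 1) * A 1 0 = 0 := by
    have h := hlN (b 0)
    rw [hcol, map_add, map_smul, map_smul, smul_eq_mul, smul_eq_mul] at h
    linear_combination h
  have h2 : l (b 0) * A 0 1 + l (b 1) * A 1 1 = 0 := by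
    have h := hlN (b 1)
    rw [hcol, map_add, map_smul, map_smul, smul_eq_mul, smul_eq_mul] at h
    linear_combination h
  -- `λ` is onto: `x l₁ + y l₂ = 1`
  obtain ⟨u, hu⟩ := hl 1
  have h3 : b.repr u 0 * l (b 0) + b.repr u 1 * l (b 1) = 1 := by
    have hsum := b.sum_repr u
    rw [Fin.sum_univ_two] at hsum
    rw [← hsum, map_add, map_smul, map_smul, smul_eq_mul, smul_eq_mul] at hu
    linear_combination hu
  -- `det (1 + N) = 1` in coordinates
  have h4 : (1 + A 0 0) * (1 + A 1 1) - A 0 1 * A 1 0 = 1 := by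
    have hM : LinearMap.toMatrix b b (LinearMap.id + N) = 1 + A := by
      rw [map_add, LinearMap.toMatrix_id, hA]
    have hd := LinearMap.det_toMatrix b (LinearMap.id + N)
    rw [hM, Matrix.det_fin_two, hdet] at hd
    have e00 : (1 + A : Matrix (Fin 2) (Fin 2) R) 0 0 = 1 + A 0 0 := by
      rw [Matrix.add_apply, Matrix.one_apply_eq]
    have e11 : (1 + A : Matrix (Fin 2) (Fin 2) R) 1 1 = 1 + A 1 1 := by
      rw [Matrix.add_apply, Matrix.one_apply_eq]
    have e01 : (1 + A : Matrix (Fin 2) (Fin 2) R) 0 1 = A 0 1 := by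
      rw [Matrix.add_apply, Matrix.one_apply_ne (by decide), zero_add]
    have e10 : (1 + A : Matrix (Fin 2) (Fin 2) R) 1 0 = A 1 0 := by
      rw [Matrix.add_apply, Matrix.one_apply_ne (by decide), zero_add]
    rw [e00, e11, e01, e10] at hd
    exact hd
  -- `det A = 0`, `tr A = 0`
  have hdetA : A 0 0 * A 1 1 - A 0 1 * A 1 0 = 0 := by
    linear_combination (-(A 0 0 * A 1 1 - A 0 1 * A 1 0)) * h3 +
      (b.repr u 0 * A 1 1 - b.repr u 1 * A 0 1) * h1 +
      (b.repr u 1 * A 0 0 - b.repr u 0 * A 1 0) * h2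
  have htr : A 0 0 + A 1 1 = 0 := by linear_combination h4 - hdetA
  -- Cayley–Hamilton: `A * A = 0`
  have hAA : A * A = 0 := by
    ext i j
    fin_cases i <;> fin_cases j <;>
      simp only [Matrix.mul_apply, Fin.sum_univ_two, Matrix.zero_apply, Fin.isValue, Fin.zero_eta,
        Fin.mk_one]
    · linear_combination A 0 0 * htr + (-1 : R) * hdetA
    · linear_combination A 0 1 * htr
    · linear_combination A 1 0 * htr
    · linear_combination A 1 1 * htr + (-1 : R) * hdetA
  -- back to `N`
  have hNN : LinearMap.toMatrix b b (N ∘ₗ N) = 0 := by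
    rw [LinearMap.toMatrix_comp b b b, hA, hAA]
  exact (LinearMap.toMatrix b b).map_eq_zero_iff.mp hNN

/-! ### §2 Squaring an (Im)-witness -/

section Curve

variable (W : WeierstrassCurve ℚ) [W.IsElliptic] (p : ℕ) [Fact p.Prime]

/-- **`det ρ_{E,p}(σ) = 1` for `σ ∈ G_{ℚ(μ_{p^∞})}`**: if `σ` fixes every `p`-power root of unity
of `ℚ̄` then its determinant on `T_pE` is `≡ 1 (mod p^{n+1})` for every `n` (tree theorem
`toZModPow_det_galoisRepTate_eq` with `c = 1`, from the Weil pairing `exists_weilPairing_holds`,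
Silverman *AEC* III.8.1), hence `= 1` (`PadicInt.ext_of_toZModPow`).
[cite: SilvermanAEC2009, Prop. III.8.1 and proof of Prop. III.8.6] -/
theorem det_galoisRepTate_eq_one_of_smul_eq_self (σ : absoluteGaloisGroup ℚ)
    (hσ : ∀ (n : ℕ) (t : AlgebraicClosure ℚ), t ^ p ^ n = 1 → σ • t = t) :
    LinearMap.det (W.galoisRepTate p σ : W.tateModule p →ₗ[ℤ_[p]] W.tateModule p) = 1 := by
  have hp : p.Prime := Fact.out
  have hpQ : (p : ℚ) ≠ 0 := Nat.cast_ne_zero.mpr hp.ne_zero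
  have h0 : ∀ x y : ZMod (p ^ 0), x = y := by
    rw [pow_zero]
    exact fun x y ↦ Subsingleton.elim x y
  refine PadicInt.ext_of_toZModPow.mp fun n ↦ ?_
  cases n with
  | zero => exact h0 _ _
  | succ n =>
    rw [toZModPow_det_galoisRepTate_eq W p hpQ n (exists_weilPairing_holds W (p ^ (n + 1))) σ 1
      (fun t ht ↦ by rw [pow_one]; exact hσ (n + 1) t ht), map_one, Nat.cast_one]

/-- **Squaring an (Im)-witness.** For an elliptic curve `E/ℚ`, an odd prime `p` and
`σ ∈ G_{ℚ(μ_{p^∞})}` with `T_pE/(ρ(σ) - 1)T_pE ≅ ℤ_p`, the element `σ²` has the SAME coinvariant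
lattice: `(ρ(σ²) - 1)T_pE = (ρ(σ) - 1)T_pE`. Indeed `N = ρ(σ) - 1` is killed by the onto functional
`T_pE → T_pE/NT_pE ≅ ℤ_p`, and `det(1 + N) = det ρ(σ) = χ_p(σ) = 1`
(`det_galoisRepTate_eq_one_of_smul_eq_self`), so `N² = 0` (`comp_self_eq_zero_of_det_eq_one` on a
`ℤ_p`-basis of `T_pE`, Silverman *AEC* III.7.1) and `ρ(σ²) - 1 = (1 + N)² - 1 = 2N`, whose range is
that of `N` as `2 ∈ ℤ_p^×` (tree `WeierstrassCurve.isUnit_two_padicInt`). [folklore] -/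
theorem range_galoisRepTate_sq_sub_id_eq (hp2 : p ≠ 2) (σ : absoluteGaloisGroup ℚ)
    (hσ : ∀ (n : ℕ) (t : AlgebraicClosure ℚ), t ^ p ^ n = 1 → σ • t = t)
    (e : (W.tateModule p ⧸ LinearMap.range (W.galoisRepTate p σ - LinearMap.id)) ≃ₗ[ℤ_[p]] ℤ_[p]) :
    LinearMap.range (W.galoisRepTate p (σ * σ) - LinearMap.id) =
      LinearMap.range (W.galoisRepTate p σ - LinearMap.id) := by
  have hp : p.Prime := Fact.out
  have hpQ : (p : ℚ) ≠ 0 := Nat.cast_ne_zero.mpr hp.ne_zero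
  haveI := module_free_tateModule_holds W p
  haveI := module_finite_tateModule_holds W p
  let b := Module.finBasisOfFinrankEq ℤ_[p] (W.tateModule p) (finrank_tateModule_eq_two_holds W p hpQ)
  obtain ⟨N, hN⟩ : ∃ N : W.tateModule p →ₗ[ℤ_[p]] W.tateModule p,
      W.galoisRepTate p σ - LinearMap.id = N := ⟨_, rfl⟩
  have hρ : (W.galoisRepTate p σ : W.tateModule p →ₗ[ℤ_[p]] W.tateModule p) = LinearMap.id + N := by
    rw [← hN, add_sub_cancel]
  rw [hN] at e ⊢
  -- the onto functional killing `N`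
  let l : W.tateModule p →ₗ[ℤ_[p]] ℤ_[p] := e.toLinearMap ∘ₗ (LinearMap.range N).mkQ
  have hlN : ∀ x, l (N x) = 0 := fun x ↦ by
    change e ((LinearMap.range N).mkQ (N x)) = 0
    rw [Submodule.mkQ_apply, (Submodule.Quotient.mk_eq_zero _).mpr (LinearMap.mem_range_self N x),
      map_zero]
  have hl : Function.Surjective l := e.surjective.comp (Submodule.mkQ_surjective _)
  have hdet : LinearMap.det (LinearMap.id + N) = 1 := by
    rw [← hρ]
    exact det_galoisRepTate_eq_one_of_smul_eq_self W p σ hσ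
  have hNN : N ∘ₗ N = 0 := comp_self_eq_zero_of_det_eq_one b N l hlN hl hdet
  -- `ρ(σ²) - 1 = 2N`
  have hsq : (W.galoisRepTate p (σ * σ) : W.tateModule p →ₗ[ℤ_[p]] W.tateModule p) - LinearMap.id =
      (2 : ℤ_[p]) • N := by
    apply LinearMap.ext
    intro x
    have hx : N (N x) = 0 := by rw [← LinearMap.comp_apply, hNN, LinearMap.zero_apply]
    rw [map_mul, LinearMap.sub_apply, Module.End.mul_apply, hρ]
    simp only [LinearMap.add_apply, LinearMap.id_apply, map_add, hx, add_zero, two_smul]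
    abel
  rw [hsq]
  apply le_antisymm
  · rintro _ ⟨x, rfl⟩
    exact ⟨(2 : ℤ_[p]) • x, by rw [LinearMap.smul_apply, map_smul]⟩
  · rintro _ ⟨x, rfl⟩
    obtain ⟨v, hv⟩ := (WeierstrassCurve.isUnit_two_padicInt (p := p) hp2).exists_left_inv
    refine ⟨v • x, ?_⟩
    rw [LinearMap.smul_apply, map_smul, smul_smul, mul_comm, hv, one_smul]

/-! ### §3 Transport along a sign-twisted isomorphism of curves -/

/-- **`T_p` of a `χ`-twisted isomorphism commutes with squares.** If `f : E₁(ℚ̄) ≃+ E₂(ℚ̄)` is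
additive and equivariant-up-to-sign at every `σ ∈ Γ_ℚ` (`f(σP) = ±σ f(P)`, the sign depending on
`σ`), then `T_p f : T_pE₁ ≃ T_pE₂` (`TateModule.map` of `f` and `f⁻¹`, as in the tree's
`exists_rationalTateModule_equiv_of_addEquiv`) satisfies `T_p f (σ² x) = σ² T_p f (x)`: the sign
squares away. [folklore] -/
theorem exists_tateModule_equiv_sq_of_addEquiv_signed {W₁ W₂ : WeierstrassCurve ℚ}
    (f : geomPoints W₁ ≃+ geomPoints W₂)
    (hf : ∀ σ : absoluteGaloisGroup ℚ,
      (∀ P, f (σ • P) = σ • f P) ∨ (∀ P, f (σ • P) = -(σ • f P))) :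
    ∃ T : W₁.tateModule p ≃ₗ[ℤ_[p]] W₂.tateModule p,
      ∀ (σ : absoluteGaloisGroup ℚ) (x : W₁.tateModule p), T ((σ * σ) • x) = (σ * σ) • T x := by
  let T : W₁.tateModule p →ₗ[ℤ_[p]] W₂.tateModule p := TateModule.map p f.toAddMonoidHom
  let T' : W₂.tateModule p →ₗ[ℤ_[p]] W₁.tateModule p := TateModule.map p f.symm.toAddMonoidHom
  have h1 : T'.comp T = LinearMap.id := by
    change (TateModule.map p f.symm.toAddMonoidHom).comp (TateModule.map p f.toAddMonoidHom) = _
    rw [← TateModule.map_comp, ← TateModule.map_id (p := p) (A := geomPoints W₁)]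
    congr 1
    ext a
    exact f.symm_apply_apply a
  have h2 : T.comp T' = LinearMap.id := by
    change (TateModule.map p f.toAddMonoidHom).comp (TateModule.map p f.symm.toAddMonoidHom) = _
    rw [← TateModule.map_comp, ← TateModule.map_id (p := p) (A := geomPoints W₂)]
    congr 1
    ext b
    exact f.apply_symm_apply b
  refine ⟨LinearEquiv.ofLinear T T' h2 h1, fun σ x ↦ ?_⟩
  have hsq : ∀ P : geomPoints W₁, f ((σ * σ) • P) = (σ * σ) • f P := fun P ↦ by
    rcases hf σ with h | h
    · rw [mul_smul, h, h, mul_smul]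
    · rw [mul_smul, h, h, smul_neg, neg_neg, mul_smul]
  change T ((σ * σ) • x) = (σ * σ) • T x
  refine TateModule.ext fun n ↦ ?_
  rw [TateModule.proj_map, TateModule.proj_smul_of_distribMulAction,
    TateModule.proj_smul_of_distribMulAction, TateModule.proj_map]
  exact hsq _

/-- **(Im) passes through a `χ`-twisted isomorphism at odd `p`.** If `f : E₁(ℚ̄) ≃+ E₂(ℚ̄)` is
additive and equivariant up to sign at every `σ`, `E₂` elliptic and `p ≠ 2`, then (Im) for `E₂`
gives (Im) for `E₁`: square the witness (`range_galoisRepTate_sq_sub_id_eq`; `σ²` still fixes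
`μ_{p^∞}`) and transport the coinvariant quotient along `T_p f`
(`exists_tateModule_equiv_sq_of_addEquiv_signed`, `Submodule.Quotient.equiv`). [folklore] -/
theorem bigIm_of_addEquiv_signed (hp2 : p ≠ 2) {W₁ W₂ : WeierstrassCurve ℚ} [W₂.IsElliptic]
    (f : geomPoints W₁ ≃+ geomPoints W₂)
    (hf : ∀ σ : absoluteGaloisGroup ℚ,
      (∀ P, f (σ • P) = σ • f P) ∨ (∀ P, f (σ • P) = -(σ • f P)))
    (h : BigIm W₂ p) : BigIm W₁ p := by
  obtain ⟨σ, hσμ, ⟨e⟩⟩ := h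
  have hσ : ∀ (n : ℕ) (t : AlgebraicClosure ℚ), t ^ p ^ n = 1 → σ • t = t :=
    fun n t ht ↦ hσμ t n ht
  obtain ⟨T, hT⟩ := exists_tateModule_equiv_sq_of_addEquiv_signed p f hf
  -- the ranges correspond under `T`
  have hcomm : (T : W₁.tateModule p →ₗ[ℤ_[p]] W₂.tateModule p) ∘ₗ
      (W₁.galoisRepTate p (σ * σ) - LinearMap.id) =
      (W₂.galoisRepTate p (σ * σ) - LinearMap.id) ∘ₗ (T : W₁.tateModule p →ₗ[ℤ_[p]] W₂.tateModule p) := by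
    apply LinearMap.ext
    intro x
    rw [LinearMap.comp_apply, LinearMap.comp_apply, LinearMap.sub_apply, LinearMap.sub_apply,
      map_sub, LinearMap.id_apply, LinearMap.id_apply, galoisRepTate_apply_apply,
      galoisRepTate_apply_apply, LinearEquiv.coe_coe, hT]
  have hmap : (LinearMap.range (W₁.galoisRepTate p (σ * σ) - LinearMap.id)).map
      (T : W₁.tateModule p →ₗ[ℤ_[p]] W₂.tateModule p) =
      LinearMap.range (W₂.galoisRepTate p σ - LinearMap.id) := by
    rw [← LinearMap.range_comp, hcomm, LinearMap.range_comp_of_range_eq_top _ T.range,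
      range_galoisRepTate_sq_sub_id_eq W₂ p hp2 σ hσ e]
  refine ⟨σ * σ, fun ζ n hζ ↦ ?_, ⟨(Submodule.Quotient.equiv _ _ T hmap).trans e⟩⟩
  change (σ * σ) • ζ = ζ
  rw [mul_smul, hσ n ζ hζ, hσ n ζ hζ]

/-- **(Im) is invariant under quadratic twist at every odd prime**: for `p ≠ 2` and `d ∈ ℚ^×`,
`E^{(d)}` satisfies (Im) at `p` iff `E` does (`bigIm_of_addEquiv_signed` along the
`χ_d`-equivariant `E^{(d)}(ℚ̄) ≃+ E(ℚ̄)`, `exists_addEquiv_geomPoints_quadraticTwist_signed`, and its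
inverse). [cite: SilvermanAEC2009, X.5 Cor. 5.4 and X.2 Prop. 2.4] -/
theorem bigIm_quadraticTwist_iff (hp2 : p ≠ 2) {d : ℚ} (hd : d ≠ 0) :
    haveI := W.isElliptic_quadraticTwist hd
    BigIm (W.quadraticTwist d) p ↔ BigIm W p := by
  haveI := W.isElliptic_quadraticTwist hd
  haveI : NeZero (2 : ℚ) := ⟨two_ne_zero⟩
  obtain ⟨f, hf⟩ := W.exists_addEquiv_geomPoints_quadraticTwist_signed hd
  have hf' : ∀ σ : absoluteGaloisGroup ℚ,
      (∀ Q, f.symm (σ • Q) = σ • f.symm Q) ∨ (∀ Q, f.symm (σ • Q) = -(σ • f.symm Q)) := by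
    intro σ
    rcases hf σ with h | h
    · left
      intro Q
      apply f.injective
      rw [AddEquiv.apply_symm_apply, h, AddEquiv.apply_symm_apply]
    · right
      intro Q
      apply f.injective
      rw [AddEquiv.apply_symm_apply, map_neg, h, AddEquiv.apply_symm_apply, neg_neg]
  exact ⟨fun h ↦ bigIm_of_addEquiv_signed p hp2 f.symm hf' h,
    fun h ↦ bigIm_of_addEquiv_signed p hp2 f hf h⟩

/-- **(Im) for any `ℚ`-model of the twist**: if `C • E^{(d)} = Wd` over `ℚ` (e.g. `Wd` a globally
minimal model) then, for `p ≠ 2`, `Wd` satisfies (Im) at `p` iff `E` does (the change of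
variables is `Γ_ℚ`-equivariant on points: `geomPointsEquiv_smul`).
[cite: SilvermanAEC2009, X.5 Cor. 5.4] -/
theorem bigIm_iff_of_model_twist (hp2 : p ≠ 2) {d : ℚ} (hd : d ≠ 0) {Wd : WeierstrassCurve ℚ}
    [Wd.IsElliptic] (hWd : ∃ C : VariableChange ℚ, C • W.quadraticTwist d = Wd) :
    BigIm Wd p ↔ BigIm W p := by
  haveI := W.isElliptic_quadraticTwist hd
  obtain ⟨C, rfl⟩ := hWd
  rw [← bigIm_quadraticTwist_iff W p hp2 hd]
  let e : geomPoints (W.quadraticTwist d) ≃+ geomPoints (C • W.quadraticTwist d) :=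
    geomPointsEquiv (W.quadraticTwist d) C
  have he : ∀ σ : absoluteGaloisGroup ℚ,
      (∀ P, e (σ • P) = σ • e P) ∨ (∀ P, e (σ • P) = -(σ • e P)) :=
    fun σ ↦ Or.inl fun P ↦ geomPointsEquiv_smul (W.quadraticTwist d) C σ P
  have he' : ∀ σ : absoluteGaloisGroup ℚ,
      (∀ P, e.symm (σ • P) = σ • e.symm P) ∨ (∀ P, e.symm (σ • P) = -(σ • e.symm P)) := by
    intro σ
    left
    intro P
    apply e.injective
    rw [AddEquiv.apply_symm_apply, geomPointsEquiv_smul, AddEquiv.apply_symm_apply]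
  exact ⟨fun h ↦ bigIm_of_addEquiv_signed p hp2 e he h,
    fun h ↦ bigIm_of_addEquiv_signed p hp2 e.symm he' h⟩

/-- **The form consumers want: (Im) for `E` gives (Im) for every quadratic twist at odd `p`.**
For `p ≠ 2`, `d ≠ 0` and any `ℚ`-model `Wd` of `E^{(d)}`: `BigIm W p → BigIm Wd p`. This is the
step Yan–Zhu's proof of Thm. 5.2 / Cor. 5.4 uses for `(E, E^K)` under the printed hypothesis
(Im) for `E` alone. [cite: YanZhu2024MainConjNonCM, proof of Thm. 4.9 (= v4 Thm. 5.2, l.1146–1148) and Cor. 5.4 (l.1183), hypothesis (Im) for the twist] -/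
theorem bigIm_twist_of_bigIm (hp2 : p ≠ 2) {d : ℚ} (hd : d ≠ 0) {Wd : WeierstrassCurve ℚ}
    [Wd.IsElliptic] (hWd : ∃ C : VariableChange ℚ, C • W.quadraticTwist d = Wd)
    (hIm : BigIm W p) : BigIm Wd p :=
  (bigIm_iff_of_model_twist W p hp2 hd hWd).mpr hIm

end Curve

/-! ### §4 Row C16 (scoreboard row D3) -/

section RowC16

variable {W : WeierstrassCurve ℚ} [W.IsElliptic] [W.IsGloballyMinimal] {p : ℕ} [Fact p.Prime]

/-- **Row C16 / D3: `E` and every quadratic twist satisfy (Im) at `3` together**, from the row's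
own (Im) (`RowC16.bigIm`, granted Wuthrich 2014 Lemma 20) and twist-stability at the odd prime
`3` (`bigIm_twist_of_bigIm`) — the pair of image hypotheses Yan–Zhu's proof uses for `(E, E^K)`,
for every `K`, on all 4 814 classes of the row. [cite: Wuthrich2014, Lemma 20 (p. 399)] -/
theorem RowC16.bigIm_twist_of_imHyp
    (hW20 : Wuthrich2014.lemma20_surjective_threeAdic_of_semistable) (h : RowC16 W p) {d : ℚ}
    (hd : d ≠ 0) {Wd : WeierstrassCurve ℚ} [Wd.IsElliptic]
    (hWd : ∃ C : VariableChange ℚ, C • W.quadraticTwist d = Wd) : BigIm W p ∧ BigIm Wd p := by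
  have him := RowC16.bigIm hW20 h
  obtain ⟨rfl, -, -, -⟩ := h
  exact ⟨him, bigIm_twist_of_bigIm W 3 (by decide) hd hWd him⟩

end RowC16

end Summit.BirchSwinnertonDyer.Rank1Residual

end
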